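import Literature.NumberTheory.DiophantineGeometry.FrobeniusCorrespondence
import Summits.ResolutionOfSingularities.ResolutionOfSingularities.Theorems.FrobeniusClosingClosingLemma
import Mathlib.RingTheory.Nullstellensatz
import HarnessLib

/-!
# Closing lemma toolkit (6): Varshavsky's Cor. 2 from his Thm. 1, and `ClosingLemma` from Thm. 1

Route `FrobeniusClosing`, support item `ClosingLemma` (stmt-ResolutionOfSingularities-16348).

The vendored file `Literature/NumberTheory/DiophantineGeometry/FrobeniusCorrespondence.lean` records
two named facts: `thm1_affine` (Varshavsky 2018, Thm. 1: an irreducible bi-dominant affine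
correspondence `C ⊆ X × X` over `𝔽̄_p`, `X` defined over `𝔽_q`, meets the graph of every large
power of Frobenius) and `cor2_affine` (Cor. 2: those points are Zariski dense in `C`).  As the
printed proof says, Cor. 2 is Thm. 1 applied to the open piece `C ∩ D(h')`, which is still
irreducible with the same closure and still bi-dominant.  `cor2_of_thm1` proves exactly this
(point-set bookkeeping with vanishing ideals), so that the tree's conditional `ClosingLemma` rests on
the headline theorem alone: `closingLemma_of_thm1_affine : thm1_affine → ClosingLemma`.
OURS; elementary. [folklore]
-/

noncomputable section

-- single-problem summit: the doubled namespace component `ResolutionOfSingularities` is forced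
set_option linter.dupNamespace false

open MvPolynomial
open Literature.NumberTheory.DiophantineGeometry.Varshavsky2014
  (locus IsDefinedOver frob thm1_affine cor2_affine)
open Summit.ResolutionOfSingularities.ResolutionOfSingularities.Theses.FrobeniusClosing (ClosingLemma)

namespace Summit.ResolutionOfSingularities.ResolutionOfSingularities.Theorems.FrobeniusClosing.ClosingArena

variable {F : Type*} [Field F] {τ : Type*}

/-- The basic open piece `C ∩ D(h')` of `C = V(T) ∩ D(h)` is `V(T) ∩ D(h h')`. [folklore] -/
theorem locus_mul (T : Set (MvPolynomial τ F)) (h h' : MvPolynomial τ F) :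
    locus T (h * h') = {w | w ∈ locus T h ∧ MvPolynomial.eval w h' ≠ 0} := by
  ext w
  simp only [locus, Set.mem_setOf_eq, map_mul, mul_ne_zero_iff, and_assoc]

/-- A non-empty basic open piece of an irreducible point set is dense in it (same vanishing
ideal). [folklore] -/
theorem vanishingIdeal_inter_basicOpen {V : Set (τ → F)} (hV : (vanishingIdeal F V).IsPrime)
    {h' : MvPolynomial τ F} (hh' : ∃ w ∈ V, MvPolynomial.eval w h' ≠ 0) :
    vanishingIdeal F {w | w ∈ V ∧ MvPolynomial.eval w h' ≠ 0} = vanishingIdeal F V := by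
  apply le_antisymm
  · intro f hf
    have hprod : f * h' ∈ vanishingIdeal F V := by
      rw [mem_vanishingIdeal_iff]
      intro w hw
      rw [map_mul]
      by_cases hw' : MvPolynomial.eval w h' = 0
      · have : aeval w h' = 0 := hw'
        rw [this, mul_zero]
      · rw [(mem_vanishingIdeal_iff.1 hf) w ⟨hw, hw'⟩, zero_mul]
    rcases hV.mem_or_mem hprod with h1 | h1
    · exact h1
    · exfalso
      obtain ⟨w, hw, hne⟩ := hh'
      exact hne ((mem_vanishingIdeal_iff.1 h1) w hw)
  · exact vanishingIdeal_anti_mono fun w hw => hw.1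

/-- The image of a dense subset under a coordinate projection is dense in the image.
[folklore] -/
theorem vanishingIdeal_image_eq_of_eq {σ : Type*} {V' V : Set (τ → F)} (hsub : V' ⊆ V)
    (heq : vanishingIdeal F V' = vanishingIdeal F V) (π : σ → τ) :
    vanishingIdeal F ((fun w => w ∘ π) '' V') = vanishingIdeal F ((fun w => w ∘ π) '' V) := by
  apply le_antisymm
  · intro f hf
    rw [mem_vanishingIdeal_iff]
    rintro _ ⟨w, hw, rfl⟩
    rw [← aeval_rename]
    have hmem : rename π f ∈ vanishingIdeal F V := by
      rw [← heq, mem_vanishingIdeal_iff]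
      intro w' hw'
      rw [aeval_rename]
      exact (mem_vanishingIdeal_iff.1 hf) _ ⟨w', hw', rfl⟩
    exact (mem_vanishingIdeal_iff.1 hmem) w hw
  · exact vanishingIdeal_anti_mono (Set.image_mono hsub)

/-- **Varshavsky's Cor. 2 from his Thm. 1** (the printed one-line proof: apply Thm. 1 to the open
piece `C ∩ D(h')`). [cite: Varshavsky2014, Thm. 1 and Cor. 2] -/
theorem cor2_of_thm1 (hthm1 : thm1_affine) : cor2_affine := by
  intro p _ F _ _ _ _ a ha N S g T h hS hg hX hC hsub hdom₁ hdom₂ n₀ h' hh'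
  have hlocus : locus T (h * h') = {w | w ∈ locus T h ∧ MvPolynomial.eval w h' ≠ 0} :=
    locus_mul T h h'
  have hdense : MvPolynomial.vanishingIdeal F (locus T (h * h')) =
      MvPolynomial.vanishingIdeal F (locus T h) := by
    rw [hlocus]; exact vanishingIdeal_inter_basicOpen hC hh'
  have hsub' : locus T (h * h') ⊆ locus T h := by
    rw [hlocus]; exact fun w hw => hw.1
  have hC' : (MvPolynomial.vanishingIdeal F (locus T (h * h'))).IsPrime := by
    rw [hdense]; exact hC
  obtain ⟨n₁, hn₁⟩ := hthm1 p F a ha N S g T (h * h') hS hg hX hC'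
    (fun w hw => hsub w (hsub' hw))
    (by rw [vanishingIdeal_image_eq_of_eq hsub' hdense Sum.inl, hdom₁])
    (by rw [vanishingIdeal_image_eq_of_eq hsub' hdense Sum.inr, hdom₂])
  obtain ⟨w, hw, hfrob⟩ := hn₁ (max n₀ n₁) (le_max_right _ _)
  rw [hlocus] at hw
  exact ⟨max n₀ n₁, w, le_max_left _ _, hw.1, hw.2, hfrob⟩

/-- **`ClosingLemma` conditionally on Varshavsky's Theorem 1 alone** (the headline printed theorem;
`thm1_affine` is the vendored named fact). [cite: Varshavsky2014, Thm. 1]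
[cite: Hrushovski2004, Cor. 1.2] -/
theorem closingLemma_of_thm1_affine (hthm1 : thm1_affine) : ClosingLemma :=
  closingLemma_of_cor2_affine (cor2_of_thm1 hthm1)

end Summit.ResolutionOfSingularities.ResolutionOfSingularities.Theorems.FrobeniusClosing.ClosingArena

end
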